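import Mathlib
import Summits.NavierStokesRegularity.NavierStokesRegularity.Theorems.EulerZoomLiouvillePowerGaugeEulerLiouvilleSpiralLocDataUnify
import Summits.NavierStokesRegularity.NavierStokesRegularity.Theorems.EulerZoomLiouvillePowerGaugeEulerLiouvilleSpiralPastEnergyGrowth
import Summits.NavierStokesRegularity.NavierStokesRegularity.Theorems.EulerZoomLiouvillePowerGaugeEulerLiouvilleSpiralProfileDissipation
import Summits.NavierStokesRegularity.NavierStokesRegularity.Theorems.EulerZoomLiouvillePowerGaugeEulerLiouvilleSpiralExtension
import Summits.NavierStokesRegularity.NavierStokesRegularity.Theorems.EulerZoomLiouvillePowerGaugeEulerLiouvilleSelfSimilarPastProfileEquations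
import Summits.NavierStokesRegularity.NavierStokesRegularity.Theorems.EulerZoomLiouvillePowerGaugeEulerLiouvilleSpiralPressureSlaving
import Summits.NavierStokesRegularity.NavierStokesRegularity.Theorems.EulerZoomLiouvillePowerGaugeEulerLiouvilleSpiralPastPressureGrowth
import Summits.NavierStokesRegularity.NavierStokesRegularity.Theorems.EulerZoomLiouvillePowerGaugeEulerLiouvilleSpiralProfileEquation
import Summits.NavierStokesRegularity.NavierStokesRegularity.Theorems.EulerZoomLiouvillePowerGaugeEulerLiouvilleSpiralProfileDivFree
import Summits.NavierStokesRegularity.NavierStokesRegularity.Theorems.EulerZoomLiouvillePowerGaugeEulerLiouvilleSpiralProfilePoisson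
import Summits.NavierStokesRegularity.NavierStokesRegularity.Theorems.EulerZoomLiouvillePowerGaugeEulerLiouvilleSpiralProfileEnergyRadial
import HarnessLib

/-!
# Crux `EulerZoomLiouville.PowerGaugeEulerLiouville` (stmt-NavierStokesRegularity-19832), line `relative_equilibria` (ns-idea-11): R3a-ASM —
# ★★ THE SPIRAL DICTIONARY `Spiral.exists_locData_of_pastSpiral` (= `Sig.stub_spiralLocData` of `Lines/relative_equilibria.lean`, Theorems side)

Route №10 `EulerZoomLiouville` (NavierStokesRegularity), crux E; width seat ns-ezl-w1 g10 under the LEAD ns-typeII-p2 g17 (KEY R3a-ASM).  Composition, by name,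
of the R3a wave (recipe `Lines/relative-equilibria.md` P1–P7; `Past.exists_locData_of_past` / `Past.profileData_of_past` verbatim with the spiral bricks):

* P4 (ns-sfl-p1 g11) `Spiral.inClass_pastSpiralPressure` — pressure slaving: the class pressure is replaced by a representative `p′ = p` a.e. with a SCALAR
  spiral profile `P` (measurable), the class constant unchanged; `Spiral.profile_pressure_growth_of_gaugeD_pastSpiral` — (D₁);
* P2 (ns-idea-11 g11, port ns-ezl-w1) `Spiral.profile_energy_growth_of_gaugeA_pastSpiral` — (A₁);
* P3 (ns-ezl-w1) `Spiral.exists_profileGradient_growth_of_pastSpiral` — the profile gradient `G` and (E₁);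
* P5 (ns-ezl-w1) `Spiral.isDistributional_spiralCollapse_of_pastSpiral` — the origin-centred spiral pair is a distributional Euler pair;
* P6 (ns-ezl-w2 g8) `SpiralProfileEquation.weak_spiral_profile_equation` / `spiral_profile_isWeaklyDivFree` / `spiral_profile_pressure_poisson` — the SPIRAL weak
  profile equation (linear terms `⟪V, Dψ(Sy)⟫ + ⟪SV, ψ⟫`), weak incompressibility, the pressure Poisson equation;
* P7 (ns-ezl-w3 g9) `Spiral.profile_local_energy_equality_radial` — the local energy identity for RADIAL-GRADIENT tests (torque terms vanish);
* step 0 (ns-ezl-w1) `Spiral.locData_unify` — thresholds `L ≥ 2 − T₁ ↦ L ≥ 1`, one constant `c'`.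

★★ `Spiral.exists_locData_of_pastSpiral (hρ : 0 < ρ) (hρh : ρ ≤ ½) (hcls : InClass-unfolded) (hT₁ : T₁ ≤ 0) (hTT₁ : T₁ ≤ T) (hS : skew) (hu : IsPastSpiral-unfolded)` :
the conclusion of `Sig.stub_spiralLocData` VERBATIM (with the line's `HasRadialGradient θ` unfolded as `∀ z, ∃ m, gradient θ z = m • z`, exactly the hypothesis of the
LEAD's `Spiral.pastSpiral_trivial_of_locData_of_subExtremal`, …SpiralEndgame): R3a-MEM = that theorem ∘ this one.

WHAT THIS IS NOT: not NS, not E, not the crux: the dictionary of ONE symmetry stratum (Perelman's rotated self-similar ansatz) of the OPEN crux class; with it the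
sub-extremal spiral members are trivial (binder `¬ IsPastSpiralSubExtremal ρ u` of `stub_nonSelfSimilarRest`, v118); 19832 OPEN; no summit statement is proved by this file.
[folklore; ChaeTsai2013DSS p. 4; PineauVicol2026 §1; BronziShvydkoy2015 Thm 1.1]
-/

noncomputable section
set_option linter.dupNamespace false
open MeasureTheory Set Filter Topology Metric Function TopologicalSpace
open scoped ENNReal NNReal RealInnerProductSpace ContDiff Laplacian InnerProductSpace
namespace Summit.NavierStokesRegularity.NavierStokesRegularity.Theorems.PowerGaugeEulerLiouville
open Literature.Analysis Literature.Analysis.FunctionSpaces Literature.Analysis.FluidPDE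
namespace Spiral
variable {S : EuclideanSpace ℝ (Fin 3) →L[ℝ] EuclideanSpace ℝ (Fin 3)}

/-- ★★ **R3a — THE SPIRAL DICTIONARY** (`Sig.stub_spiralLocData` of `Lines/relative_equilibria.lean`, Theorems side; `HasRadialGradient` unfolded).  For a member
of the class (`0 < ρ ≤ ½`) whose velocity is a Perelman spiral about `(T, x₀)` with skew generator `S` and profile `V` for `τ < T₁` (`T₁ ≤ 0`, `T₁ ≤ T`), there are
a scalar pressure profile `P`, a profile gradient `G` and ONE constant `c'` with: measurability of `V, P, G`; `G` a weak derivative of `V`; the growth bounds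
(A₁)/(E₁)/(D₁) for `L ≥ 1`; the weak pressure Poisson equation; and the profile local energy identity for every test with radial gradient.  Composition of the R3a
wave P2–P7 (credits in the module docstring). [folklore; ChaeTsai2013DSS p. 4; BronziShvydkoy2015 Thm 1.1] -/
theorem exists_locData_of_pastSpiral {ρ : ℝ} (hρ : 0 < ρ) (hρh : ρ ≤ 1 / 2)
    {u : ℝ → EuclideanSpace ℝ (Fin 3) → EuclideanSpace ℝ (Fin 3)} {p : ℝ → EuclideanSpace ℝ (Fin 3) → ℝ}
    {H : ℝ → EuclideanSpace ℝ (Fin 3) → EuclideanSpace ℝ (Fin 3) →L[ℝ] EuclideanSpace ℝ (Fin 3)} {c : ℝ≥0}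
    {T T₁ : ℝ} {x₀ : EuclideanSpace ℝ (Fin 3)} {V : EuclideanSpace ℝ (Fin 3) → EuclideanSpace ℝ (Fin 3)}
    (hcls : IsSuitableWeakSolutionOn (slab (EuclideanSpace ℝ (Fin 3)) (Set.Iio 0) isOpen_Iio) 0 0 u p ∧
      HasWeakSpatialGradientOn (slab (EuclideanSpace ℝ (Fin 3)) (Set.Iio 0) isOpen_Iio) u H ∧
      (∀ a : ℝ, 0 < a →
        ENNReal.ofReal (a ^ (2 * ρ)) * cknA a (0 : ℝ × EuclideanSpace ℝ (Fin 3)) u +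
            ENNReal.ofReal (a ^ ρ) * cknE a (0 : ℝ × EuclideanSpace ℝ (Fin 3)) H +
          ENNReal.ofReal (a ^ (2 * ρ)) * cknD a (0 : ℝ × EuclideanSpace ℝ (Fin 3)) p ≤ (c : ℝ≥0∞)))
    (hT₁ : T₁ ≤ 0) (hTT₁ : T₁ ≤ T) (hS : ∀ x y : EuclideanSpace ℝ (Fin 3), ⟪S x, y⟫ = -⟪x, S y⟫)
    (hu : ∀ τ : ℝ, τ < T₁ → u τ = fun x => (T - τ) ^ (1 / (2 + ρ) - 1) •
      NormedSpace.exp ((Real.log (T - τ)) • S) (V (NormedSpace.exp ((-Real.log (T - τ)) • S) ((T - τ) ^ (-(1 / (2 + ρ))) • (x - x₀))))) :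
    ∃ (P : EuclideanSpace ℝ (Fin 3) → ℝ) (G : EuclideanSpace ℝ (Fin 3) → EuclideanSpace ℝ (Fin 3) →L[ℝ] EuclideanSpace ℝ (Fin 3)) (c' : ℝ≥0),
      AEStronglyMeasurable V volume ∧ AEStronglyMeasurable P volume ∧ AEStronglyMeasurable G volume ∧
      HasWeakFDerivOn (⊤ : Opens (EuclideanSpace ℝ (Fin 3))) volume V G ∧
      (∀ L : ℝ, 1 ≤ L → ∫⁻ y in ball (0 : EuclideanSpace ℝ (Fin 3)) L, ‖V y‖ₑ ^ 2 ≤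
        (c' : ℝ≥0∞) * ENNReal.ofReal (L ^ (1 - 2 * ρ))) ∧
      (∀ L : ℝ, 1 ≤ L →
        ∫⁻ y in ball (0 : EuclideanSpace ℝ (Fin 3)) L, ENNReal.ofReal (frobeniusNormSq (G y)) ≤
          ENNReal.ofReal (L ^ (1 - ρ)) * (ENNReal.ofReal ((1 - ρ) / (2 + ρ)) * (c' : ℝ≥0∞))) ∧
      (∀ L : ℝ, 1 ≤ L →
        ∫⁻ y in ball (0 : EuclideanSpace ℝ (Fin 3)) L, ‖P y‖ₑ ^ (3 / 2 : ℝ) ≤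
          ENNReal.ofReal (L ^ (2 - 2 * ρ)) * (ENNReal.ofReal ((2 - 2 * ρ) / (2 + ρ)) * (c' : ℝ≥0∞))) ∧
      (∀ θ : EuclideanSpace ℝ (Fin 3) → ℝ, ContDiff ℝ (⊤ : ℕ∞) θ → HasCompactSupport θ →
        ∫ y, P y * (Δ θ) y = -∫ y, fderiv ℝ (fderiv ℝ θ) y (V y) (V y)) ∧
      (∀ θ : EuclideanSpace ℝ (Fin 3) → ℝ, IsTestFunctionOn (⊤ : Opens (EuclideanSpace ℝ (Fin 3))) θ →
        (∀ z : EuclideanSpace ℝ (Fin 3), ∃ m : ℝ, gradient θ z = m • z) →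
        (2 - 5 * (1 / (2 + ρ))) * ∫ x, θ x * ‖V x‖ ^ 2 =
          (∫ x, (‖V x‖ ^ 2 + 2 * P x) * ⟪V x, gradient θ x⟫) +
            (1 / (2 + ρ)) * ∫ x, ‖V x‖ ^ 2 * ⟪x, gradient θ x⟫) := by
  have hρ1 : ρ < 1 := by linarith
  -- ### P4 (sfl-p1): pressure slaving — replace `p` by the slaved representative `p'` with a spiral scalar profile `P`
  obtain ⟨P, p', hPmeas, hp, -, hcls'⟩ :=
    inClass_pastSpiralPressure (γ := 1 / (2 + ρ)) (by linarith : -1 / 2 < ρ) hT₁ hTT₁ hS hcls hu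
  obtain ⟨hsw, hH, hgauge⟩ := hcls'
  have hA : ∀ a : ℝ, 0 < a → ENNReal.ofReal (a ^ (2 * ρ)) * cknA a (0 : ℝ × EuclideanSpace ℝ (Fin 3)) u ≤ (c : ℝ≥0∞) :=
    fun a ha => le_trans (le_trans le_self_add le_self_add) (hgauge a ha)
  have hE : ∀ a : ℝ, 0 < a → ENNReal.ofReal (a ^ ρ) * cknE a (0 : ℝ × EuclideanSpace ℝ (Fin 3)) H ≤ (c : ℝ≥0∞) :=
    fun a ha => le_trans (le_trans le_add_self le_self_add) (hgauge a ha)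
  have hD : ∀ a : ℝ, 0 < a → ENNReal.ofReal (a ^ (2 * ρ)) * cknD a (0 : ℝ × EuclideanSpace ℝ (Fin 3)) p' ≤ (c : ℝ≥0∞) :=
    fun a ha => le_trans le_add_self (hgauge a ha)
  have hPm : AEStronglyMeasurable P volume := hPmeas.aestronglyMeasurable
  -- ### measurability of the slab pressure
  have hpm : AEStronglyMeasurable (uncurry p') (volume.restrict (Iio (0 : ℝ) ×ˢ (univ : Set (EuclideanSpace ℝ (Fin 3))))) := by
    have := hsw.distributional.2.2.1.aestronglyMeasurable
    simpa [slab] using this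
  -- ### P5: the origin-centred spiral pair is distributional
  have hext := isDistributional_spiralCollapse_of_pastSpiral (γ := 1 / (2 + ρ)) hT₁ hTT₁ x₀ hS hsw.distributional hu hp
  -- ### P2T / P3 / P4: growth
  have hgrowthA := profile_energy_growth_of_gaugeA_pastSpiral hρ hρh hT₁ hTT₁ x₀ hS hu hA
  obtain ⟨G, hGm, hVG, hHae, hgrowthE⟩ := exists_profileGradient_growth_of_pastSpiral hρ hρ1 hT₁ hTT₁ x₀ hS hH hu hE
  have hgrowthD := profile_pressure_growth_of_gaugeD_pastSpiral hρ hρ1 hT₁ hTT₁ x₀ hS hpm hp hD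
  obtain ⟨CA, hCA, hA'⟩ := id hgrowthA
  obtain ⟨CE, hCE, hE'⟩ := id hgrowthE
  obtain ⟨CD, hCD, hD'⟩ := id hgrowthD
  -- measurability of `V` (from the weak derivative)
  have hVm : AEStronglyMeasurable V volume := by
    have h := hVG.locallyIntegrableOn
    rw [Opens.coe_top, locallyIntegrableOn_univ] at h
    exact h.aestronglyMeasurable
  -- ### integrability on all balls (generic, as untwisted)
  have hV2fin := Past.lintegral_ball_lt_top_of_growth hCA hA'
  have hGfin := Past.lintegral_ball_lt_top_of_growth hCE hE'
  have hPfin := Past.lintegral_ball_lt_top_of_growth hCD hD'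
  have hV2R := Past.memLp_two_ball_of_lintegral_lt_top hVm hV2fin
  have hG2R := Past.memLp_two_ball_gradient_of_lintegral_lt_top hGm hGfin
  have hP32R := Past.memLp_threeHalves_ball_of_lintegral_lt_top hPm hPfin
  have hV6R := Past.memLp_six_ball_of_gradient hVm hVG hV2R hGfin
  have hVloc : LocallyIntegrable V volume := locallyIntegrableOn_univ.1 (by simpa only [Opens.coe_top] using hVG.locallyIntegrableOn)
  have hV2loc : LocallyIntegrable (fun y => ‖V y‖ ^ 2) volume := by
    refine (locallyIntegrable_iff).2 fun K hK => ?_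
    obtain ⟨r, hr⟩ := hK.isBounded.subset_ball (0 : EuclideanSpace ℝ (Fin 3))
    have h := (hV2R r).integrable_norm_pow two_ne_zero
    exact IntegrableOn.mono_set (show IntegrableOn (fun y => ‖V y‖ ^ 2) (ball 0 r) volume from h) hr
  have hPloc : LocallyIntegrable P volume := by
    refine (locallyIntegrable_iff).2 fun K hK => ?_
    obtain ⟨r, hr⟩ := hK.isBounded.subset_ball (0 : EuclideanSpace ℝ (Fin 3))
    haveI : IsFiniteMeasure ((volume : Measure (EuclideanSpace ℝ (Fin 3))).restrict
        (ball (0 : EuclideanSpace ℝ (Fin 3)) r)) :=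
      isFiniteMeasure_restrict.2 measure_ball_lt_top.ne
    have h : IntegrableOn P (ball (0 : EuclideanSpace ℝ (Fin 3)) r) volume :=
      memLp_one_iff_integrable.1 ((hP32R r).mono_exponent (by
        rw [ENNReal.le_div_iff_mul_le (Or.inl (by norm_num)) (Or.inl (by norm_num))]; norm_num))
    exact h.mono_set hr
  -- ### P6 (ezl-w2): spiral weak profile equation, div-free, Poisson, read off the origin-centred extension `hext`
  have heq : ∀ ψ : EuclideanSpace ℝ (Fin 3) → EuclideanSpace ℝ (Fin 3), IsTestFunctionOn (⊤ : Opens (EuclideanSpace ℝ (Fin 3))) ψ →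
      ∫ x, (⟪V x, fderiv ℝ ψ x (V x)⟫ + P x * VectorCalculus.divergence ψ x + (1 / (2 + ρ)) * ⟪V x, fderiv ℝ ψ x x⟫ +
        ⟪V x, fderiv ℝ ψ x (S x)⟫ + (4 * (1 / (2 + ρ)) - 1) * ⟪V x, ψ x⟫ + ⟪S (V x), ψ x⟫) = 0 :=
    fun ψ hψ => SpiralProfileEquation.weak_spiral_profile_equation hS hext (fun _ _ => rfl) (fun _ _ => rfl) hVloc hV2loc hPloc hψ
  have hdiv : IsWeaklyDivFree V := SpiralProfileEquation.spiral_profile_isWeaklyDivFree hS hext (fun _ _ => rfl) hVloc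
  have hPoisson : ∀ θ : EuclideanSpace ℝ (Fin 3) → ℝ, ContDiff ℝ (⊤ : ℕ∞) θ → HasCompactSupport θ →
      ∫ y, P y * (Δ θ) y = -∫ y, fderiv ℝ (fderiv ℝ θ) y (V y) (V y) :=
    fun θ hθ hθc => SpiralProfileEquation.spiral_profile_pressure_poisson hS hext hVm (fun _ _ => rfl) (fun _ _ => rfl) hV2loc hPloc hθ hθc
  -- ### P7 (ezl-w3): radial LEE (`…SpiralProfileEnergyRadial`)
  have hEE : ∀ θ : EuclideanSpace ℝ (Fin 3) → ℝ, IsTestFunctionOn (⊤ : Opens (EuclideanSpace ℝ (Fin 3))) θ →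
      (∀ z : EuclideanSpace ℝ (Fin 3), ∃ m : ℝ, gradient θ z = m • z) →
      (2 - 5 * (1 / (2 + ρ))) * ∫ x, θ x * ‖V x‖ ^ 2 =
        (∫ x, (‖V x‖ ^ 2 + 2 * P x) * ⟪V x, gradient θ x⟫) + (1 / (2 + ρ)) * ∫ x, ‖V x‖ ^ 2 * ⟪x, gradient θ x⟫ :=
    fun θ hθ hrad => profile_local_energy_equality_radial hVG hV6R hG2R hPm hP32R hdiv hS heq hθ hrad
  obtain ⟨c', h⟩ := locData_unify hρ hρh hT₁ hVm hPm hGm hVG hCA hCE hCD hA' hE' hD' hPoisson hEE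
  exact ⟨P, G, c', h⟩

end Spiral
end Summit.NavierStokesRegularity.NavierStokesRegularity.Theorems.PowerGaugeEulerLiouville
end
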